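import Literature.NumberTheory.LFunctions.LeastPrimeOutsideSubgroupGRH
import HarnessLib

/-!
# Fourier optimization and the GRH constants for the least quadratic non-residue, the least prime
# quadratic residue, the least character non-residue and the least prime in an arithmetic progression
# (Carneiro–Milinovich–Quesada-Herrera–Ramos, Math. Comp. 2025, §1: Theorems 1–6, Corollary 7)

Topic `Literature/NumberTheory/LFunctions` (namespace `Literature.NumberTheory.LFunctions`; the paper's
vocabulary lives in the sub-namespace `CMQR2025`). Statement layer (one file for §1 of the source,
D-0064); the 2025 successor of `LeastPrimeOutsideSubgroupGRH.lean` (Lamzouri–Li–Soundararajan 2015,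
§§1.1–1.2), whose GRH bounds it sharpens ASYMPTOTICALLY: `n_p ≤ (log p)²` (LLS Cor 1.1, absolute) and
`n_χ ≤ (0.794 + o(1)) log² q` (LLS/Corrigendum) become `limsup n_p/log² p ≤ 𝒞(1)⁻² < 0.7615`;
`P(a, q) ≤ (φ(q) log q)²` (LLS Cor 1.2, absolute, `lamzouriLiSoundararajan2015_corollary12`) becomes
`limsup P(a,q)/(φ(q) log q)² ≤ 𝒞(3)⁻² < 8/9`. Typed by the cross-ladder literature-typing seat
`littype-FP2-2` (g2) for the cells `parity-realchar` (GRH column: what GRH gives where the exceptional-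
character world gives Linnik-type statements) and `landau-siegel` (§C harvest row P-197, screened there,
no T-row: "GRH-conditional consumer").

Source: E. Carneiro, M. B. Milinovich, E. Quesada-Herrera, A. P. Ramos, *Fourier optimization, the least
quadratic non-residue, and the least prime in an arithmetic progression*, Math. Comp. (2025),
doi:10.1090/mcom/4154 = arXiv:2404.08380 (v2 the latest) [CarneiroEtAl2025]. Read: the corpus TeX of the
arXiv version (held as `paper:arxiv-2404.08380`, chunks p0003–p0005 = §1, p0010–p0015 = §§3–5 (proofs),
p0020–p0021 = §7); theorem numbering below is that of the arXiv version (§1: Theorems 1–6, Corollary 7);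
the journal pagination is not held, so locators are "Theorem n (§1.m)".

## What the source says (verbatim, §1)

Normalisation: `F̂(t) := ∫_{−∞}^{∞} e^{−2πixt} F(x) dx` (= Mathlib's `𝓕 F t`, `Real.fourier_real_eq`).
`𝒜 = {F : ℝ → ℂ ; F ∈ L¹(ℝ) ; F̂ is real-valued}`; `G₊ = max{G, 0}`, `G₋ = max{−G, 0}`.

* **(EP1), (1.5)–(1.6)** (§1.3). "Given `0 ≤ A < ∞`, find
  `𝒞(A) := sup_{0 ≠ F ∈ 𝒜} (2π/‖F‖₁)( ∫_{−∞}^0 F̂(t)e^{πt} dt − ∫_0^∞ F̂₋(t)e^{πt} dt − A∫_0^∞ F̂₊(t)e^{πt} dt )`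
  […]. For `A = ∞`, find `𝒞(∞) := sup_{0 ≠ F ∈ 𝒜_∞} (2π/‖F‖₁)( ∫_{−∞}^0 F̂(t)e^{πt} dt − ∫_0^∞ F̂₋(t)e^{πt} dt )`,
  where […] `𝒜_∞ = {F ∈ 𝒜 ; F̂(t) ≤ 0 for t ≥ 0}`." ((1.1) is the case `A = 1`, (1.3) the case `A = 3`.)
* **Theorem 1** (§1.1). "Assume GRH. Let `n_p` be the least quadratic non-residue modulo a prime `p`. Then
  `limsup_{p→∞} n_p/log² p ≤ 𝒞(1)⁻² < 0.7615`." Followed by: "assuming GRH, we prove that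
  `n_p < (380/499) log² p` when `p` is sufficiently large". Remark (iii) after Corollary 7: "Theorem 1 is an
  immediate consequence of Theorem 6 and Corollary 7 upon letting `q` be prime and letting `χ` be the
  Legendre symbol modulo `q` (so that `ℓ = 2`)."
* **Theorem 2** (§1.1). "Assume GRH. Let `r_p` be the least prime quadratic residue modulo a prime `p`.
  Then `limsup_{p→∞} r_p/log² p ≤ 𝒞(1)⁻² < 0.7615`."
* **Theorem 3** (§1.2). "Assume GRH. Let `q ∈ ℕ` and `a ∈ ℤ` with `gcd(a,q) = 1`. The least prime `P(a,q)`
  that is congruent to `a` modulo `q` verifies `limsup_{q→∞} P(a,q)/(φ(q) log q)² ≤ 𝒞(3)⁻² < 8/9`."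
* **Theorem 4** (§1.3). "(i) The supremum in (1.5)–(1.6) restricted to the functions `F ∈ 𝒜` (or `F ∈ 𝒜_∞`
  in case `A = ∞`) with `F̂ ∈ C_c^∞(ℝ)`, still yields `𝒞(A)`. (ii) The function `A ↦ 𝒞(A)` is continuous
  and non-increasing for `0 ≤ A ≤ ∞`. (iii) One has the exact endpoint values `𝒞(0) = 2` and `𝒞(∞) = 1`.
  (iv) For `0 < A < 1`, one has the bound
  `𝒞(A) ≥ max{ 2 − 2(A+1)log((3−A)/(A+1))/|log A| + 2A ; 1 }`."
* **Theorem 5** (§1.3). "`1.31706 < 𝒞(1/4) < 1.33509; 1.27722 < 𝒞(1/3) < 1.28781; 1.22112 < 𝒞(1/2) < 1.23080;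
  1.14600 < 𝒞(1) < 1.14731; 1.06082 < 𝒞(3) < 1.06240.`"
* **(1.10), Theorem 6** (§1.4). "`n_χ := min{n ∈ ℕ; χ(n) ≠ 0, 1}` […] Assume GRH. Let `q ∈ ℕ` and let `χ` be
  a non-principal Dirichlet character modulo `q` of order `ℓ`. Then the least character non-residue
  `n_χ` satisfies `limsup_{q→∞} n_χ/log² q ≤ 𝒞(1/(ℓ−1))⁻²`."
* **Corollary 7** (§1.4). "Under the same hypotheses of Theorem 6, we have that as `q → ∞`: (i) If `ℓ = 2`,
  then `n_χ ≤ (0.7615 + o(1)) log² q`. (ii) If `ℓ = 3`, then `n_χ ≤ (0.6707 + o(1)) log² q`. (iii) If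
  `ℓ = 4`, then `n_χ ≤ (0.6131 + o(1)) log² q`. (iv) If `ℓ = 5`, then `n_χ ≤ (0.5765 + o(1)) log² q`.
  (v) For `ℓ ≥ 6`, one has
  `n_χ ≤ { ¼ (1 − (ℓ/(ℓ−1)) log((3ℓ−4)/ℓ)/log(ℓ−1) + 1/(ℓ−1))⁻² + o_ℓ(1) } log² q`." ("From Theorem 5 and
  the lower bound (1.7) we immediately have the following corollary.")

## How it is typed

* **The extremal constant.** `CMQR2025.C A` is DEFINED as the supremum of Theorem 4 (i): over `F : ℝ → ℂ`
  integrable with `F̂` real-valued, `C^∞` and compactly supported and `‖F‖₁ > 0`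
  (`CMQR2025.IsAdmissible`), of the printed functional `CMQR2025.functional A F` — with `F̂` written out
  as the integral `∫ e^{−2πixt} F(x) dx` (`CMQR2025.ft`, PROVED equal to Mathlib's `𝓕 F`,
  `CMQR2025.ft_eq_fourier`). On this class every integral in (1.5) converges absolutely (`F̂` is bounded
  and compactly supported), so the Bochner integrals below are the printed ones; by Theorem 4 (i) this
  supremum IS the paper's `𝒞(A)` (for the full class `𝒜` the integrals `∫_0^∞ F̂_± e^{πt}` may diverge,
  which a Bochner integral would silently replace by `0`). Likewise `CMQR2025.CInf` (`𝒞(∞)`, over the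
  subclass `F̂(t) ≤ 0` for `t ≥ 0`, `CMQR2025.IsAdmissibleInf`). `sSup` of a set of reals (the paper's
  Theorems 4–5 make the sets non-empty and bounded, `𝒞(A) ≤ 𝒞(0) = 2`).
* **"`limsup_{q→∞} X ≤ c`"** is typed as: for every `ε > 0` there is a threshold beyond which `X ≤ (c + ε)·scale`
  — for Theorem 3 uniformly in the residue `a`, for Theorem 6 uniformly in the character `χ` of the given
  order `ℓ` (the printed `limsup` is over `q → ∞` with `a`, resp. `χ`, attached to each `q`; equivalently
  the threshold form — and the proofs, §5.2 resp. §4.2, carry every error term as `O_F(·)` independent of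
  `a`, resp. as `O_F(ℓ ·)`); the threshold may depend on `ℓ` (`o_ℓ(1)`).
* "The least such object is `≤ X`" is typed as "some such object is `≤ X`" (equivalent): `P(a,q)` as in
  `lamzouriLiSoundararajan2015_corollary12` (`a : ℕ` coprime to `q`, a prime `p ≡ a (mod q)`); `r_p` as a
  prime `r` with Legendre symbol `(r/p) = 1`; `n_χ` ((1.10), `χ(n)` for `n ∈ ℕ` with the Mathlib convention
  `χ(n) = 0` when `gcd(n, q) > 1`) as an `n : ℕ` with `χ(n) ≠ 0` and `χ(n) ≠ 1`; `n_p` is the tree's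
  `Literature.NumberTheory.Congruences.LeastNonresidue.leastNonresidue` [NivenZuckerman1966, Thm 3.9].
* GRH = the tree's `GeneralizedRiemannHypothesis` (`RHWave0.lean`), as in the LLS files.
* FIVE NAMED FACTS (D-0014: published, not proved here): `cmqr2025_theorem2`, `cmqr2025_theorem3`,
  `cmqr2025_theorem4` ((ii)–(iv); (i) is built into the definition), `cmqr2025_theorem5`,
  `cmqr2025_theorem6`. PROVED from them, as the paper says they follow: Theorem 1 in both printed forms
  (`CMQR2025.theorem1_of`: `limsup ≤ 𝒞(1)⁻²` from Theorem 6 at `ℓ = 2` with the Legendre symbol as a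
  Dirichlet character of order `2`; `CMQR2025.theorem1_lt_of`: `n_p < (380/499) log² p` for `p` large, with
  Theorem 5), Corollary 7 (i)–(iv) (`CMQR2025.corollary7_of`, from Theorems 6 and 5) and (v)
  (`CMQR2025.corollary7_v_of`, from Theorems 6 and 4 (iv), incl. the positivity of the bracket, which is
  `(A − 1)² > 0`), and the numerical form of Theorem 3 (`CMQR2025.theorem3_lt_of`:
  `P(a,q) < (8/9)(φ(q) log q)²` for `q` large, from Theorems 3 and 5).

Index only (not typed; §7, "beyond GRH"): Theorem 13 (GRH + an admissible bound `ℳ(k)` for `S(t,ψ)` ⇒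
`limsup n_χ/(ℳ(q) log n_χ)² ≤ (2π/𝒞(1/(ℓ−1)))²`), Conjecture 14 (`|S(t,χ)| ≤ (B+o(1))√(log q log log q) +
O(log τ)`), Corollary 15 (GRH + Conj. 14 ⇒ `limsup n_χ/(log q (log log q)³) ≤ (2πB/𝒞(1/(ℓ−1)))²`); the
authors' open problems ("sharper generic lower bounds, or the exact rate of convergence of `𝒞(A)` to `2` as
`A → 0⁺`"; an admissible `ℳ(q) = c log q/log log q` with `c < 1/(4π)`) are recorded in the seat's NOTES,
not typed (conjectures are not Literature).

LABEL (cell rule): statement layer; GRH is a HYPOTHESIS inside each number-theoretic fact; Theorems 4–5 are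
unconditional real-analysis/numerics statements about `𝒞`; no compute here. WHAT THIS IS NOT: nothing
unconditional about `n_p`, `r_p`, `P(a,q)` (print: Burgess, Linnik–Vinogradov, Xylouris `L = 5.2`, all
quoted in §1); no explicit threshold (the results are asymptotic — the absolute bounds remain LLS's).

## References

* [CarneiroEtAl2025] Math. Comp. (2025), doi:10.1090/mcom/4154 = arXiv:2404.08380 — §1: (1.1), (1.3),
  (1.5)–(1.7), (1.10)–(1.11), Theorems 1–6, Corollary 7; §§4–5 (proofs; uniformity); §7 (index only).
* [LamzouriLiSoundararajan2015] Math. Comp. 84 (2015) — the absolute GRH bounds this paper sharpens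
  asymptotically (`LeastPrimeOutsideSubgroupGRH.lean`).
* [NivenZuckerman1966] Thm 3.9 (the tree's `leastNonresidue`).
-/

noncomputable section

open MeasureTheory Real Filter Topology

namespace Literature.NumberTheory.LFunctions

namespace CMQR2025

/-! ### The Fourier extremal problem (EP1) -/

/-- `F̂(t) = ∫ e^{−2πixt} F(x) dx`, the paper's normalisation of the Fourier transform (written out; equal
to Mathlib's `𝓕 F t`, `ft_eq_fourier`). [cite: CarneiroEtAl2025, §1 (normalisation display)] -/
def ft (F : ℝ → ℂ) (t : ℝ) : ℂ :=
  ∫ x : ℝ, Complex.exp (↑(-2 * π * x * t) * Complex.I) * F x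

open scoped FourierTransform in
/-- The written-out transform is Mathlib's `𝓕`. [cite: CarneiroEtAl2025, §1 (normalisation display)] -/
theorem ft_eq_fourier (F : ℝ → ℂ) : ft F = 𝓕 F := by
  funext t
  rw [Real.fourier_real_eq_integral_exp_smul]
  rfl

/-- The weight `e^{πt}` of (1.5). [cite: CarneiroEtAl2025, §1.3 (1.5)] -/
def weight (t : ℝ) : ℝ := Real.exp (π * t)

/-- The admissible test functions of Theorem 4 (i): `F ∈ 𝒜` (integrable, `F̂` real-valued) with
`F̂ ∈ C_c^∞(ℝ)`, and `F ≠ 0` in `L¹` (`‖F‖₁ > 0`). [cite: CarneiroEtAl2025, §1.3 (class 𝒜) and Theorem 4 (i)] -/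
structure IsAdmissible (F : ℝ → ℂ) : Prop where
  integrable : Integrable F
  real : ∀ t : ℝ, (ft F t).im = 0
  smooth : ContDiff ℝ ((⊤ : ℕ∞) : WithTop ℕ∞) (fun t : ℝ => (ft F t).re)
  compactSupport : HasCompactSupport (fun t : ℝ => (ft F t).re)
  norm_pos : 0 < ∫ x : ℝ, ‖F x‖

/-- The subclass `𝒜_∞`: additionally `F̂(t) ≤ 0` for `t ≥ 0`. [cite: CarneiroEtAl2025, §1.3 (1.6), class 𝒜_∞] -/
structure IsAdmissibleInf (F : ℝ → ℂ) : Prop extends IsAdmissible F where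
  nonpos : ∀ t : ℝ, 0 ≤ t → (ft F t).re ≤ 0

/-- The functional of (EP1):
`(2π/‖F‖₁)( ∫_{−∞}^0 F̂(t)e^{πt} dt − ∫_0^∞ F̂₋(t)e^{πt} dt − A ∫_0^∞ F̂₊(t)e^{πt} dt )`,
`F̂₊ = max{F̂, 0}`, `F̂₋ = max{−F̂, 0}`. [cite: CarneiroEtAl2025, §1.3 (1.5)] -/
def functional (A : ℝ) (F : ℝ → ℂ) : ℝ :=
  2 * π / (∫ x : ℝ, ‖F x‖) *
    ((∫ t in Set.Iic (0 : ℝ), (ft F t).re * weight t) -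
      (∫ t in Set.Ioi (0 : ℝ), ((ft F t).re)⁻ * weight t) -
      A * ∫ t in Set.Ioi (0 : ℝ), ((ft F t).re)⁺ * weight t)

/-- **`𝒞(A)`**, `0 ≤ A < ∞`: the supremum of the functional (1.5) over the admissible class of
Theorem 4 (i) (which "still yields `𝒞(A)`"). [cite: CarneiroEtAl2025, §1.3 (1.5) and Theorem 4 (i)] -/
def C (A : ℝ) : ℝ :=
  sSup (functional A '' {F | IsAdmissible F})

/-- **`𝒞(∞)`**: the supremum of (1.6) over `𝒜_∞ ∩ {F̂ ∈ C_c^∞}` (there `F̂₊ = 0` on `t ≥ 0`, so the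
functional is (1.5) with any `A`; we use `A = 0`). [cite: CarneiroEtAl2025, §1.3 (1.6) and Theorem 4 (i)] -/
def CInf : ℝ :=
  sSup (functional 0 '' {F | IsAdmissibleInf F})

/-- The bracket of Theorem 4 (iv) / (1.7): `2 − 2(A+1)log((3−A)/(A+1))/|log A| + 2A`.
[cite: CarneiroEtAl2025, Theorem 4 (iv) (1.7)] -/
def lowerBracket (A : ℝ) : ℝ :=
  2 - 2 * (A + 1) * Real.log ((3 - A) / (A + 1)) / |Real.log A| + 2 * A

end CMQR2025

open CMQR2025
open Literature.NumberTheory.Congruences.LeastNonresidue (leastNonresidue)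

/-! ### The named facts (§1) -/

/-- **CMQR 2025, Theorem 2 (NAMED FACT, as printed).** "Assume GRH. Let `r_p` be the least prime quadratic
residue modulo a prime `p`. Then `limsup_{p→∞} r_p/log² p ≤ 𝒞(1)⁻²`." Rendered: for every `ε > 0` there is
`p₀` such that for every prime `p ≥ p₀` some prime `r` with `(r/p) = 1` has `r ≤ (𝒞(1)⁻² + ε) log² p`.
(The printed continuation "`< 0.7615`" is Theorem 5's `1.14600 < 𝒞(1)`.)
[cite: CarneiroEtAl2025, Theorem 2 (§1.1)] -/
def cmqr2025_theorem2 : Prop :=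
  GeneralizedRiemannHypothesis →
    ∀ ε : ℝ, 0 < ε → ∃ p₀ : ℕ, ∀ (p : ℕ) [Fact p.Prime], p₀ ≤ p →
      ∃ r : ℕ, r.Prime ∧ legendreSym p r = 1 ∧ (r : ℝ) ≤ ((C 1)⁻¹ ^ 2 + ε) * Real.log p ^ 2

/-- **CMQR 2025, Theorem 3 (NAMED FACT, as printed).** "Assume GRH. Let `q ∈ ℕ` and `a ∈ ℤ` with
`gcd(a,q) = 1`. The least prime `P(a,q)` that is congruent to `a` modulo `q` verifies
`limsup_{q→∞} P(a,q)/(φ(q) log q)² ≤ 𝒞(3)⁻²`." Rendered (threshold form, uniform in `a`, see the module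
docstring): for every `ε > 0` there is `q₀` such that for all `q ≥ q₀` and all `a` coprime to `q` some prime
`p ≡ a (mod q)` has `p ≤ (𝒞(3)⁻² + ε)(φ(q) log q)²`. (The printed "`< 8/9`" is Theorem 5's
`1.06082 < 𝒞(3)`; see `CMQR2025.theorem3_lt_of`.) [cite: CarneiroEtAl2025, Theorem 3 (§1.2) (1.4)] -/
def cmqr2025_theorem3 : Prop :=
  GeneralizedRiemannHypothesis →
    ∀ ε : ℝ, 0 < ε → ∃ q₀ : ℕ, ∀ q : ℕ, q₀ ≤ q → ∀ a : ℕ, a.Coprime q →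
      ∃ p : ℕ, p.Prime ∧ p ≡ a [MOD q] ∧
        (p : ℝ) ≤ ((C 3)⁻¹ ^ 2 + ε) * ((Nat.totient q : ℝ) * Real.log q) ^ 2

/-- **CMQR 2025, Theorem 4 (ii)–(iv) (NAMED FACT, as printed; (i) is the definition of `CMQR2025.C`).**
"(ii) The function `A ↦ 𝒞(A)` is continuous and non-increasing for `0 ≤ A ≤ ∞`. (iii) One has the exact
endpoint values `𝒞(0) = 2` and `𝒞(∞) = 1`. (iv) For `0 < A < 1`, one has the bound
`𝒞(A) ≥ max{2 − 2(A+1)log((3−A)/(A+1))/|log A| + 2A ; 1}`." (ii) is rendered on `[0, ∞)` as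
`ContinuousOn`/`AntitoneOn`, and at `A = ∞` as `𝒞(∞) ≤ 𝒞(A)` for all `A ≥ 0` together with
`𝒞(A) → 𝒞(∞)` as `A → ∞`. [cite: CarneiroEtAl2025, Theorem 4 (§1.3) (1.7)] -/
def cmqr2025_theorem4 : Prop :=
  (ContinuousOn C (Set.Ici 0) ∧ AntitoneOn C (Set.Ici 0) ∧ (∀ A : ℝ, 0 ≤ A → CInf ≤ C A) ∧
      Tendsto C atTop (𝓝 CInf)) ∧
    (C 0 = 2 ∧ CInf = 1) ∧
    (∀ A : ℝ, 0 < A → A < 1 → max (lowerBracket A) 1 ≤ C A)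

/-- **CMQR 2025, Theorem 5 (NAMED FACT, as printed).** "One has the following bounds:
`1.31706 < 𝒞(1/4) < 1.33509; 1.27722 < 𝒞(1/3) < 1.28781; 1.22112 < 𝒞(1/2) < 1.23080;
1.14600 < 𝒞(1) < 1.14731; 1.06082 < 𝒞(3) < 1.06240.`" [cite: CarneiroEtAl2025, Theorem 5 (§1.3)] -/
def cmqr2025_theorem5 : Prop :=
  (1.31706 < C (1 / 4) ∧ C (1 / 4) < 1.33509) ∧
    (1.27722 < C (1 / 3) ∧ C (1 / 3) < 1.28781) ∧
    (1.22112 < C (1 / 2) ∧ C (1 / 2) < 1.23080) ∧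
    (1.14600 < C 1 ∧ C 1 < 1.14731) ∧
    (1.06082 < C 3 ∧ C 3 < 1.06240)

/-- **CMQR 2025, Theorem 6 (NAMED FACT, as printed).** "Assume GRH. Let `q ∈ ℕ` and let `χ` be a
non-principal Dirichlet character modulo `q` of order `ℓ`. Then the least character non-residue `n_χ`
[(1.10): `n_χ := min{n ∈ ℕ ; χ(n) ≠ 0, 1}`] satisfies `limsup_{q→∞} n_χ/log² q ≤ 𝒞(1/(ℓ−1))⁻²`."
Rendered (threshold form, uniform in `χ` of order `ℓ`; threshold depending on `ℓ`): for all `ℓ ≥ 2` and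
`ε > 0` there is `q₀` such that for every `q ≥ q₀` and every non-principal `χ` mod `q` of order `ℓ` some
`n ∈ ℕ` with `χ(n) ≠ 0, 1` has `n ≤ (𝒞(1/(ℓ−1))⁻² + ε) log² q`.
[cite: CarneiroEtAl2025, Theorem 6 (§1.4) and (1.10)] -/
def cmqr2025_theorem6 : Prop :=
  GeneralizedRiemannHypothesis →
    ∀ ℓ : ℕ, 2 ≤ ℓ → ∀ ε : ℝ, 0 < ε → ∃ q₀ : ℕ, ∀ q : ℕ, q₀ ≤ q →
      ∀ χ : DirichletCharacter ℂ q, χ ≠ 1 → orderOf χ = ℓ →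
        ∃ n : ℕ, χ (n : ZMod q) ≠ 0 ∧ χ (n : ZMod q) ≠ 1 ∧
          (n : ℝ) ≤ ((C (1 / ((ℓ : ℝ) - 1)))⁻¹ ^ 2 + ε) * Real.log q ^ 2

/-! ### Proved readings: Theorem 1, Corollary 7 and the numerical forms -/

namespace CMQR2025

/-! #### The Legendre symbol as a Dirichlet character of order `2` -/

/-- The quadratic character mod `p` with values in `ℂ` (the Legendre symbol as a Dirichlet character).
[folklore] -/
def legendreChar (p : ℕ) [Fact p.Prime] : DirichletCharacter ℂ p :=
  (quadraticChar (ZMod p)).ringHomComp (Int.castRingHom ℂ)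

variable {p : ℕ} [hp : Fact p.Prime]

/-- Values: `legendreChar p a = ((quadraticChar (ZMod p) a : ℤ) : ℂ)`. [folklore] -/
private theorem legendreChar_apply (a : ZMod p) :
    legendreChar p a = ((quadraticChar (ZMod p) a : ℤ) : ℂ) := by
  simp [legendreChar, MulChar.ringHomComp_apply]

/-- On naturals: `legendreChar p n = (n/p)` (the Legendre symbol). [folklore] -/
private theorem legendreChar_natCast (n : ℕ) :
    legendreChar p (n : ZMod p) = ((legendreSym p n : ℤ) : ℂ) := by
  rw [legendreChar_apply, legendreSym, Int.cast_natCast]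

/-- For an odd prime `p` the quadratic character is non-principal ("letting `χ` be the Legendre symbol
modulo `q` (so that `ℓ = 2`)"). [cite: CarneiroEtAl2025, §1.4 Remark (iii) and §4.4 ("`χ` is the Legendre symbol modulo `p`. Then `χ` is primitive")] -/
theorem legendreChar_ne_one (hp2 : p ≠ 2) : legendreChar p ≠ 1 := by
  intro h
  obtain ⟨a, ha⟩ := quadraticChar_exists_neg_one (F := ZMod p)
    (by rw [ZMod.ringChar_zmod_n]; exact hp2)
  have ha0 : a ≠ 0 := by
    rintro rfl
    simp at ha
  have hu : IsUnit a := isUnit_iff_ne_zero.mpr ha0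
  have h1 : legendreChar p a = 1 := by
    rw [h]; exact MulChar.one_apply hu
  rw [legendreChar_apply, ha] at h1
  norm_num at h1

/-- For an odd prime `p` the quadratic character has order `ℓ = 2` ("letting `χ` be the Legendre symbol
modulo `q` (so that `ℓ = 2`)"). [cite: CarneiroEtAl2025, §1.4 Remark (iii)] -/
theorem orderOf_legendreChar (hp2 : p ≠ 2) : orderOf (legendreChar p) = 2 := by
  haveI : Fact (Nat.Prime 2) := Nat.fact_prime_two
  refine orderOf_eq_prime ?_ (legendreChar_ne_one hp2)
  ext u
  rw [MulChar.pow_apply_coe, MulChar.one_apply_coe, legendreChar_apply]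
  have hu0 : (u : ZMod p) ≠ 0 := u.ne_zero
  have hsq := quadraticChar_sq_one hu0
  exact_mod_cast hsq

/-- If `legendreChar p n ≠ 0, 1` then `(n/p) = −1`. [folklore] -/
private theorem legendreSym_eq_neg_one_of_ne {n : ℕ} (h0 : legendreChar p (n : ZMod p) ≠ 0)
    (h1 : legendreChar p (n : ZMod p) ≠ 1) : legendreSym p n = -1 := by
  rw [legendreChar_natCast] at h0 h1
  have hn0 : ((n : ℤ) : ZMod p) ≠ 0 := by
    intro h
    apply h0
    rw [(legendreSym.eq_zero_iff p n).mpr h]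
    simp
  rcases legendreSym.eq_one_or_neg_one p hn0 with h | h
  · exact absurd (by rw [h]; simp) h1
  · exact h

/-- If `legendreChar p n ≠ 0, 1` (`p` odd) then the least quadratic non-residue is `≤ n`. [folklore]
[cite: NivenZuckerman1966, Thm 3.9 (definition of the least positive quadratic non-residue)] -/
theorem leastNonresidue_le_of_ne (hp2 : p ≠ 2) {n : ℕ} (h0 : legendreChar p (n : ZMod p) ≠ 0)
    (h1 : legendreChar p (n : ZMod p) ≠ 1) : leastNonresidue p hp2 ≤ n := by
  have hleg := legendreSym_eq_neg_one_of_ne h0 h1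
  have hn : 0 < n := by
    rcases Nat.eq_zero_or_pos n with rfl | h
    · exfalso
      rw [legendreChar_natCast, Nat.cast_zero, legendreSym.at_zero] at h0
      exact h0 (by simp)
    · exact h
  exact Nat.find_min' _ ⟨hn, hleg⟩

/-! #### Theorem 1 -/

/-- **CMQR 2025, Theorem 1, first form (PROVED from Theorem 6, as the paper's Remark (iii) after
Corollary 7 says).** Under GRH, for every `ε > 0` there is `p₀` such that for every prime `p ≥ p₀`, `p ≠ 2`,
the least quadratic non-residue satisfies `n_p ≤ (𝒞(1)⁻² + ε) log² p` — i.e.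
`limsup_{p→∞} n_p/log² p ≤ 𝒞(1)⁻²`. [cite: CarneiroEtAl2025, Theorem 1 (§1.1) and Remark (iii) (§1.4)] -/
theorem theorem1_of (h6 : cmqr2025_theorem6) (hGRH : GeneralizedRiemannHypothesis)
    {ε : ℝ} (hε : 0 < ε) :
    ∃ p₀ : ℕ, ∀ (p : ℕ) [Fact p.Prime] (hp2 : p ≠ 2), p₀ ≤ p →
      (leastNonresidue p hp2 : ℝ) ≤ ((C 1)⁻¹ ^ 2 + ε) * Real.log p ^ 2 := by
  obtain ⟨q₀, hq₀⟩ := h6 hGRH 2 le_rfl ε hε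
  refine ⟨q₀, fun p _ hp2 hp => ?_⟩
  obtain ⟨n, hn0, hn1, hle⟩ :=
    hq₀ p hp (legendreChar p) (legendreChar_ne_one hp2) (orderOf_legendreChar hp2)
  have hcast : (leastNonresidue p hp2 : ℝ) ≤ n := by
    exact_mod_cast leastNonresidue_le_of_ne hp2 hn0 hn1
  refine hcast.trans ?_
  have h21 : (1 / (((2 : ℕ) : ℝ) - 1)) = 1 := by norm_num
  rw [h21] at hle
  exact hle

/-- From Theorem 5: `𝒞(1)⁻² < 380/499 (= 0.76152…)`; indeed `1.146⁻² = 0.76143…`.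
[cite: CarneiroEtAl2025, Theorem 5 (§1.3) and the sentence after Theorem 1] -/
theorem inv_C_one_sq_lt (h5 : cmqr2025_theorem5) : (C 1)⁻¹ ^ 2 < 380 / 499 := by
  obtain ⟨-, -, -, ⟨h, -⟩, -⟩ := h5
  have hC : 0 < C 1 := by linarith
  have h1 : (C 1)⁻¹ < (1.146 : ℝ)⁻¹ := by
    rw [inv_lt_inv₀ hC (by norm_num)]; linarith
  have h2 : 0 ≤ (C 1)⁻¹ := inv_nonneg.mpr hC.le
  calc (C 1)⁻¹ ^ 2 < (1.146 : ℝ)⁻¹ ^ 2 := by gcongr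
    _ < 380 / 499 := by norm_num

/-- **CMQR 2025, Theorem 1, numerical form (PROVED from Theorems 6 and 5).** "Assuming GRH, we prove that
`n_p < (380/499) log² p` when `p` is sufficiently large" (`380/499 = 0.76152…`, the printed "`< 0.7615`"
rounded). [cite: CarneiroEtAl2025, Theorem 1 (§1.1) and the sentence following it] -/
theorem theorem1_lt_of (h6 : cmqr2025_theorem6) (h5 : cmqr2025_theorem5)
    (hGRH : GeneralizedRiemannHypothesis) :
    ∃ p₀ : ℕ, ∀ (p : ℕ) [Fact p.Prime] (hp2 : p ≠ 2), p₀ ≤ p →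
      (leastNonresidue p hp2 : ℝ) < 380 / 499 * Real.log p ^ 2 := by
  have hlt := inv_C_one_sq_lt h5
  set ε : ℝ := (380 / 499 - (C 1)⁻¹ ^ 2) / 2 with hε_def
  have hε : 0 < ε := by rw [hε_def]; linarith
  obtain ⟨p₀, hp₀⟩ := theorem1_of h6 hGRH hε
  refine ⟨max p₀ 2, fun p _ hp2 hp => ?_⟩
  have hp₀p : p₀ ≤ p := le_trans (le_max_left _ _) hp
  have h2p : 2 ≤ p := le_trans (le_max_right _ _) hp
  have hlog : 0 < Real.log p := Real.log_pos (by exact_mod_cast (by omega : 1 < p))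
  have hlog2 : 0 < Real.log p ^ 2 := by positivity
  calc (leastNonresidue p hp2 : ℝ) ≤ ((C 1)⁻¹ ^ 2 + ε) * Real.log p ^ 2 := hp₀ p hp2 hp₀p
    _ < 380 / 499 * Real.log p ^ 2 := by
        apply mul_lt_mul_of_pos_right _ hlog2
        rw [hε_def]; linarith

/-! #### Corollary 7 (i)–(iv) and the numerical Theorem 2 / Theorem 3 -/

/-- From Theorem 5: `𝒞(1)⁻² < 0.7615`, `𝒞(1/2)⁻² < 0.6707`, `𝒞(1/3)⁻² < 0.6131`, `𝒞(1/4)⁻² < 0.5765` (the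
constants of Corollary 7 (i)–(iv)). [cite: CarneiroEtAl2025, Theorem 5 (§1.3), Corollary 7 (§1.4)] -/
theorem inv_C_sq_lt_constants (h5 : cmqr2025_theorem5) :
    (C 1)⁻¹ ^ 2 < 0.7615 ∧ (C (1 / 2))⁻¹ ^ 2 < 0.6707 ∧ (C (1 / 3))⁻¹ ^ 2 < 0.6131 ∧
      (C (1 / 4))⁻¹ ^ 2 < 0.5765 := by
  obtain ⟨⟨h4, -⟩, ⟨h3, -⟩, ⟨h2, -⟩, ⟨h1, -⟩, -⟩ := h5
  have key : ∀ {x c b : ℝ}, 0 < c → c < x → c⁻¹ ^ 2 < b → x⁻¹ ^ 2 < b := by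
    intro x c b hc hcx hb
    have hx : 0 < x := hc.trans hcx
    have h1 : x⁻¹ < c⁻¹ := by rw [inv_lt_inv₀ hx hc]; exact hcx
    have h2 : 0 ≤ x⁻¹ := inv_nonneg.mpr hx.le
    calc x⁻¹ ^ 2 < c⁻¹ ^ 2 := by gcongr
      _ < b := hb
  refine ⟨key (by norm_num) h1 (by norm_num), key (by norm_num) h2 (by norm_num),
    key (by norm_num) h3 (by norm_num), key (by norm_num) h4 (by norm_num)⟩

/-- **CMQR 2025, Corollary 7 (i)–(iv) (PROVED from Theorems 6 and 5, as printed: "From Theorem 5 and the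
lower bound (1.7) we immediately have the following corollary").** Under GRH, as `q → ∞`, for
non-principal `χ` mod `q` of order `ℓ`: `n_χ ≤ (0.7615 + o(1)) log² q` (`ℓ = 2`), `(0.6707 + o(1)) log² q`
(`ℓ = 3`), `(0.6131 + o(1)) log² q` (`ℓ = 4`), `(0.5765 + o(1)) log² q` (`ℓ = 5`) — rendered with
`o(1) ↦ ε` beyond a threshold, the constant `c ℓ` read off the list.
[cite: CarneiroEtAl2025, Corollary 7 (i)–(iv) (§1.4)] -/
theorem corollary7_of (h6 : cmqr2025_theorem6) (h5 : cmqr2025_theorem5)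
    (hGRH : GeneralizedRiemannHypothesis) {ℓ : ℕ} {c : ℝ}
    (hℓ : (ℓ = 2 ∧ c = 0.7615) ∨ (ℓ = 3 ∧ c = 0.6707) ∨ (ℓ = 4 ∧ c = 0.6131) ∨ (ℓ = 5 ∧ c = 0.5765))
    {ε : ℝ} (hε : 0 < ε) :
    ∃ q₀ : ℕ, ∀ q : ℕ, q₀ ≤ q → ∀ χ : DirichletCharacter ℂ q, χ ≠ 1 → orderOf χ = ℓ →
      ∃ n : ℕ, χ (n : ZMod q) ≠ 0 ∧ χ (n : ZMod q) ≠ 1 ∧ (n : ℝ) ≤ (c + ε) * Real.log q ^ 2 := by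
  obtain ⟨k1, k2, k3, k4⟩ := inv_C_sq_lt_constants h5
  -- the constant of Theorem 6 at `ℓ` is below `c`
  have hℓ2 : 2 ≤ ℓ := by rcases hℓ with ⟨rfl, -⟩ | ⟨rfl, -⟩ | ⟨rfl, -⟩ | ⟨rfl, -⟩ <;> omega
  have hlt : (C (1 / ((ℓ : ℝ) - 1)))⁻¹ ^ 2 < c := by
    rcases hℓ with ⟨rfl, rfl⟩ | ⟨rfl, rfl⟩ | ⟨rfl, rfl⟩ | ⟨rfl, rfl⟩
    · have e : (1 / (((2 : ℕ) : ℝ) - 1)) = 1 := by norm_num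
      rw [e]; exact k1
    · have e : (1 / (((3 : ℕ) : ℝ) - 1)) = 1 / 2 := by norm_num
      rw [e]; exact k2
    · have e : (1 / (((4 : ℕ) : ℝ) - 1)) = 1 / 3 := by norm_num
      rw [e]; exact k3
    · have e : (1 / (((5 : ℕ) : ℝ) - 1)) = 1 / 4 := by norm_num
      rw [e]; exact k4
  obtain ⟨q₀, hq₀⟩ := h6 hGRH ℓ hℓ2 ε hε
  refine ⟨q₀, fun q hq χ hχ hord => ?_⟩
  obtain ⟨n, hn0, hn1, hle⟩ := hq₀ q hq χ hχ hord
  refine ⟨n, hn0, hn1, hle.trans ?_⟩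
  have hlog2 : 0 ≤ Real.log q ^ 2 := sq_nonneg _
  exact mul_le_mul_of_nonneg_right (by linarith) hlog2

/-- **CMQR 2025, Theorem 2, numerical continuation "`< 0.7615`" (PROVED from Theorems 2 and 5).** Under
GRH, for `p` large some prime quadratic residue `r` mod `p` has `r < 0.7615 log² p`.
[cite: CarneiroEtAl2025, Theorem 2 (§1.1), Theorem 5 (§1.3)] -/
theorem theorem2_lt_of (h2 : cmqr2025_theorem2) (h5 : cmqr2025_theorem5)
    (hGRH : GeneralizedRiemannHypothesis) :
    ∃ p₀ : ℕ, ∀ (p : ℕ) [Fact p.Prime], p₀ ≤ p →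
      ∃ r : ℕ, r.Prime ∧ legendreSym p r = 1 ∧ (r : ℝ) < 0.7615 * Real.log p ^ 2 := by
  obtain ⟨k1, -, -, -⟩ := inv_C_sq_lt_constants h5
  set ε : ℝ := (0.7615 - (C 1)⁻¹ ^ 2) / 2 with hε_def
  have hε : 0 < ε := by rw [hε_def]; linarith
  obtain ⟨p₀, hp₀⟩ := h2 hGRH ε hε
  refine ⟨max p₀ 2, fun p _ hp => ?_⟩
  have hp₀p : p₀ ≤ p := le_trans (le_max_left _ _) hp
  have h2p : 2 ≤ p := le_trans (le_max_right _ _) hp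
  obtain ⟨r, hr, hleg, hle⟩ := hp₀ p hp₀p
  have hlog : 0 < Real.log p := Real.log_pos (by exact_mod_cast (by omega : 1 < p))
  have hlog2 : 0 < Real.log p ^ 2 := by positivity
  refine ⟨r, hr, hleg, hle.trans_lt ?_⟩
  apply mul_lt_mul_of_pos_right _ hlog2
  rw [hε_def]; linarith

/-- From Theorem 5: `𝒞(3)⁻² < 8/9` (indeed `1.06082⁻² = 0.8886…`). [cite: CarneiroEtAl2025, Theorem 5 (§1.3), Theorem 3 (§1.2)] -/
theorem inv_C_three_sq_lt (h5 : cmqr2025_theorem5) : (C 3)⁻¹ ^ 2 < 8 / 9 := by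
  obtain ⟨-, -, -, -, ⟨h, -⟩⟩ := h5
  have hC : 0 < C 3 := by linarith
  have h1 : (C 3)⁻¹ < (1.06082 : ℝ)⁻¹ := by
    rw [inv_lt_inv₀ hC (by norm_num)]; exact h
  have h2 : 0 ≤ (C 3)⁻¹ := inv_nonneg.mpr hC.le
  calc (C 3)⁻¹ ^ 2 < (1.06082 : ℝ)⁻¹ ^ 2 := by gcongr
    _ < 8 / 9 := by norm_num

/-- **CMQR 2025, Theorem 3, numerical continuation "`< 8/9`" (PROVED from Theorems 3 and 5).** Under GRH
there is `q₀` such that for all `q ≥ q₀` and all `a` coprime to `q` some prime `p ≡ a (mod q)` has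
`p < (8/9)(φ(q) log q)²` — the asymptotic sharpening of `lamzouriLiSoundararajan2015_corollary12`
(`≤ (φ(q) log q)²` for all `q > 3`). [cite: CarneiroEtAl2025, Theorem 3 (§1.2) (1.4), Theorem 5 (§1.3)] -/
theorem theorem3_lt_of (h3 : cmqr2025_theorem3) (h5 : cmqr2025_theorem5)
    (hGRH : GeneralizedRiemannHypothesis) :
    ∃ q₀ : ℕ, ∀ q : ℕ, q₀ ≤ q → ∀ a : ℕ, a.Coprime q →
      ∃ p : ℕ, p.Prime ∧ p ≡ a [MOD q] ∧
        (p : ℝ) < 8 / 9 * ((Nat.totient q : ℝ) * Real.log q) ^ 2 := by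
  have hlt := inv_C_three_sq_lt h5
  set ε : ℝ := (8 / 9 - (C 3)⁻¹ ^ 2) / 2 with hε_def
  have hε : 0 < ε := by rw [hε_def]; linarith
  obtain ⟨q₀, hq₀⟩ := h3 hGRH ε hε
  refine ⟨max q₀ 3, fun q hq a ha => ?_⟩
  have hq₀q : q₀ ≤ q := le_trans (le_max_left _ _) hq
  have h3q : 3 ≤ q := le_trans (le_max_right _ _) hq
  obtain ⟨p, hp, hpa, hle⟩ := hq₀ q hq₀q a ha
  have hlog : 0 < Real.log q := Real.log_pos (by exact_mod_cast (by omega : 1 < q))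
  have hφ : 0 < (Nat.totient q : ℝ) := by exact_mod_cast Nat.totient_pos.mpr (by omega)
  have hsc : 0 < ((Nat.totient q : ℝ) * Real.log q) ^ 2 := by positivity
  refine ⟨p, hp, hpa, hle.trans_lt ?_⟩
  apply mul_lt_mul_of_pos_right _ hsc
  rw [hε_def]; linarith

/-! #### Corollary 7 (v) -/

/-- At `A = 1/(ℓ−1)`, `ℓ ≥ 3`: `A + 1 = ℓ/(ℓ−1)`, `(3−A)/(A+1) = (3ℓ−4)/ℓ`, `|log A| = log(ℓ−1)`, so the
bracket (1.7) is `lowerBracket(1/(ℓ−1)) = 2·Y`, `Y = 1 − (ℓ/(ℓ−1)) log((3ℓ−4)/ℓ)/log(ℓ−1) + 1/(ℓ−1)` the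
inner bracket of (1.11) (whose constant is `(2Y)⁻² = ¼·Y⁻²`). [cite: CarneiroEtAl2025, (1.7) and (1.11)] -/
theorem lowerBracket_inv_eq {ℓ : ℕ} (hℓ : 3 ≤ ℓ) :
    lowerBracket (1 / ((ℓ : ℝ) - 1)) =
      2 * (1 - (ℓ : ℝ) / ((ℓ : ℝ) - 1) * Real.log ((3 * (ℓ : ℝ) - 4) / ℓ) / Real.log ((ℓ : ℝ) - 1) +
        1 / ((ℓ : ℝ) - 1)) := by
  have hℓr : (3 : ℝ) ≤ ℓ := by exact_mod_cast hℓ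
  have h1 : (0 : ℝ) < (ℓ : ℝ) - 1 := by linarith
  have hℓ0 : (0 : ℝ) < ℓ := by linarith
  have hA1 : 1 / ((ℓ : ℝ) - 1) + 1 = ℓ / ((ℓ : ℝ) - 1) := by field_simp; ring
  have hfrac : (3 - 1 / ((ℓ : ℝ) - 1)) / (1 / ((ℓ : ℝ) - 1) + 1) = (3 * (ℓ : ℝ) - 4) / ℓ := by
    field_simp; ring
  have hlogA : |Real.log (1 / ((ℓ : ℝ) - 1))| = Real.log ((ℓ : ℝ) - 1) := by
    rw [one_div, Real.log_inv, abs_neg, abs_of_nonneg (Real.log_nonneg (by linarith))]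
  unfold lowerBracket
  rw [hfrac, hlogA, hA1]
  ring

/-- Positivity of the bracket: for `0 < A < 1`, `(3−A)/(A+1) < 1/A` (this is `(A−1)² > 0`), hence
`(A+1) log((3−A)/(A+1)) < (A+1)|log A|` and `lowerBracket A > 2 − 2(A+1) + 2A = 0` (the bracket
appears inverted in (1.11), so its positivity is part of the printed Corollary 7 (v)).
[cite: CarneiroEtAl2025, Theorem 4 (iv) (1.7) and Corollary 7 (v) (1.11)] -/
theorem lowerBracket_pos {A : ℝ} (hA0 : 0 < A) (hA1 : A < 1) : 0 < lowerBracket A := by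
  have hlogA : |Real.log A| = -Real.log A := abs_of_neg (Real.log_neg hA0 hA1)
  have hlogApos : 0 < -Real.log A := by linarith [Real.log_neg hA0 hA1]
  have hq : 0 < (3 - A) / (A + 1) := div_pos (by linarith) (by linarith)
  -- `(3 − A)/(A + 1) < A⁻¹` since `A(3 − A) < A + 1`, i.e. `0 < (A − 1)²`
  have hlt : (3 - A) / (A + 1) < A⁻¹ := by
    rw [div_lt_iff₀ (by linarith : (0:ℝ) < A + 1), ← sub_pos]
    have : A⁻¹ * (A + 1) - (3 - A) = (A - 1) ^ 2 / A := by field_simp; ring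
    rw [this]
    exact div_pos (by nlinarith [sq_nonneg (A - 1), sub_pos.mpr hA1]) hA0
  have hloglt : Real.log ((3 - A) / (A + 1)) < -Real.log A := by
    rw [← Real.log_inv]
    exact Real.log_lt_log hq hlt
  have hA1pos : 0 < A + 1 := by linarith
  have hkey : 2 * (A + 1) * Real.log ((3 - A) / (A + 1)) / |Real.log A| < 2 * (A + 1) := by
    rw [hlogA, div_lt_iff₀ hlogApos]
    nlinarith [hloglt, hA1pos]
  unfold lowerBracket
  linarith

/-- **CMQR 2025, Corollary 7 (v) (PROVED from Theorem 6 and Theorem 4 (iv), as printed).** Under GRH, for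
`ℓ ≥ 6` and non-principal `χ` mod `q` of order `ℓ`:
`n_χ ≤ { ¼ (1 − (ℓ/(ℓ−1))log((3ℓ−4)/ℓ)/log(ℓ−1) + 1/(ℓ−1))⁻² + o_ℓ(1) } log² q` (the `¼` multiplies
the inverse square: `𝒞(A)⁻² ≤ (2Y)⁻² = ¼Y⁻²`, `2Y` the bracket (1.7) at `A = 1/(ℓ−1)`) — rendered with
`o_ℓ(1) ↦ ε` beyond a threshold `q₀(ℓ, ε)`. (The derivation works for every `ℓ ≥ 3`; the paper states it
for `ℓ ≥ 6`, the cases `ℓ ≤ 5` being Corollary 7 (i)–(iv).) [cite: CarneiroEtAl2025, Corollary 7 (v) (§1.4) (1.11), Theorem 4 (iv) (1.7)] -/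
theorem corollary7_v_of (h6 : cmqr2025_theorem6) (h4 : cmqr2025_theorem4)
    (hGRH : GeneralizedRiemannHypothesis) {ℓ : ℕ} (hℓ : 6 ≤ ℓ) {ε : ℝ} (hε : 0 < ε) :
    ∃ q₀ : ℕ, ∀ q : ℕ, q₀ ≤ q → ∀ χ : DirichletCharacter ℂ q, χ ≠ 1 → orderOf χ = ℓ →
      ∃ n : ℕ, χ (n : ZMod q) ≠ 0 ∧ χ (n : ZMod q) ≠ 1 ∧
        (n : ℝ) ≤ (1 / 4 * (1 - (ℓ : ℝ) / ((ℓ : ℝ) - 1) * Real.log ((3 * (ℓ : ℝ) - 4) / ℓ) /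
            Real.log ((ℓ : ℝ) - 1) + 1 / ((ℓ : ℝ) - 1))⁻¹ ^ 2 + ε) * Real.log q ^ 2 := by
  obtain ⟨-, -, hiv⟩ := h4
  have hℓr : (6 : ℝ) ≤ ℓ := by exact_mod_cast hℓ
  set A : ℝ := 1 / ((ℓ : ℝ) - 1) with hA_def
  have hA0 : 0 < A := by rw [hA_def]; exact div_pos one_pos (by linarith)
  have hA1 : A < 1 := by
    rw [hA_def, div_lt_one (by linarith)]; linarith
  have hbr_pos : 0 < lowerBracket A := lowerBracket_pos hA0 hA1
  have hCge : lowerBracket A ≤ C A := le_trans (le_max_left _ _) (hiv A hA0 hA1)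
  have hCpos : 0 < C A := hbr_pos.trans_le hCge
  -- `𝒞(A)⁻² ≤ lowerBracket(A)⁻²`
  have hinv : (C A)⁻¹ ^ 2 ≤ (lowerBracket A)⁻¹ ^ 2 := by
    have : (C A)⁻¹ ≤ (lowerBracket A)⁻¹ := by
      rw [inv_le_inv₀ hCpos hbr_pos]; exact hCge
    have h0 : 0 ≤ (C A)⁻¹ := inv_nonneg.mpr hCpos.le
    gcongr
  -- `lowerBracket A = 2·Y` with `Y` the printed inner bracket of (1.11).
  have hY : lowerBracket A =
      2 * (1 - (ℓ : ℝ) / ((ℓ : ℝ) - 1) * Real.log ((3 * (ℓ : ℝ) - 4) / ℓ) / Real.log ((ℓ : ℝ) - 1) +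
        1 / ((ℓ : ℝ) - 1)) := by
    rw [hA_def]; exact lowerBracket_inv_eq (by omega)
  set Y : ℝ := 1 - (ℓ : ℝ) / ((ℓ : ℝ) - 1) * Real.log ((3 * (ℓ : ℝ) - 4) / ℓ) / Real.log ((ℓ : ℝ) - 1) +
        1 / ((ℓ : ℝ) - 1) with hY_def
  have hYpos : 0 < Y := by
    have : 0 < 2 * Y := by rw [← hY]; exact hbr_pos
    linarith
  -- `(𝒞(1/(ℓ−1)))⁻² ≤ (2Y)⁻² = ¼·Y⁻²`.
  have hfinal : (C A)⁻¹ ^ 2 ≤ 1 / 4 * Y⁻¹ ^ 2 := by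
    refine hinv.trans (le_of_eq ?_)
    rw [hY, mul_inv, mul_pow]
    norm_num
  obtain ⟨q₀, hq₀⟩ := h6 hGRH ℓ (by omega) ε hε
  refine ⟨q₀, fun q hq χ hχ hord => ?_⟩
  obtain ⟨n, hn0, hn1, hle⟩ := hq₀ q hq χ hχ hord
  refine ⟨n, hn0, hn1, hle.trans ?_⟩
  have hlog2 : 0 ≤ Real.log q ^ 2 := sq_nonneg _
  apply mul_le_mul_of_nonneg_right _ hlog2
  have : (C (1 / ((ℓ : ℝ) - 1)))⁻¹ ^ 2 = (C A)⁻¹ ^ 2 := by rw [hA_def]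
  linarith [hfinal]

end CMQR2025

end Literature.NumberTheory.LFunctions

end
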